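import Summits.RiemannHypothesis.RiemannHypothesis.Theorems.SignConeGapRungDefs
import Summits.RiemannHypothesis.RiemannHypothesis.Theorems.SignConeGapRungOneLever

/-!
# `GapRung 1`, stub `stub_gap_large` (`113 ≤ n₀`) of line `gap-rung-one`
(crux `SignConeInequality`, stmt-RiemannHypothesis-16301; cell `Cruxes/SignConeInequality/`)

The registered regime stub, verbatim: `∀ n₀ : ℕ, 113 ≤ n₀ → ∀ a : ℝ, 0 < a → SingleGapAt n₀ a`
(`SingleGapAt`, `Theorems/SignConeGapRungDefs.lean`).  Two landed arguments cover it: the mass budget of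
`signConeOscillatory_of_negativeMass_le` (negative polar mass of one gap `≤ 2A·4(sinh(log(n₀+1)/2) − sinh(log n₀/2))
≤ 0.1894·A ≤ 0.19·A` exactly from `n₀ = 113` on) and the lever theorem `singleGap_lever` (`n₀ ≥ 11`,
`Theorems/SignConeGapRungOneLever.lean`); this file uses the latter, read through the route's cone note.
-/

noncomputable section

-- `Summit.RiemannHypothesis.RiemannHypothesis.…` repeats a namespace component by design (D-0017 layout).
set_option linter.dupNamespace false

open scoped BigOperators ComplexConjugate

namespace Summit.RiemannHypothesis.RiemannHypothesis.Theorems.SignCone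

open Literature.NumberTheory.LFunctions

/-- **Stub `stub_gap_large`** (line `gap-rung-one`, rung `GapRung 1`): one dirty node gap at `n₀ ≥ 113`, every cutoff. -/
theorem stub_gap_large : ∀ n₀ : ℕ, 113 ≤ n₀ → ∀ a : ℝ, 0 < a → SingleGapAt n₀ a := by
  intro n₀ h₁ a _ha k g hg F hn hgap M
  exact singleGap_lever (g := g) (F := F) rfl (fun i => (hg i).1) (le_trans (by norm_num) h₁) hn hgap

end Summit.RiemannHypothesis.RiemannHypothesis.Theorems.SignCone

end
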